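/-
Copyright (c) 2026. All rights reserved.
Released under Apache 2.0 license as described in the file LICENSE.
-/
import Summits.Langlands.Langlands.Theorems.SoloInformedDcrisTrivialCharpoly
import Summits.Langlands.Langlands.Theorems.SoloInformedBmaxInvariantsTCriterion
import HarnessLib

/-!
# The `𝟙_m` instance of the crystalline clause for EVERY `p`-adic field, given Colmez's criterion (TC) (rung Λ11)

Programme `solo-Langlands-informed`, repair D2-cris of `Summit.Langlands` (`SpecC` = the comparison
`B_max(F)^{Γ_F} = K₀` over the constructed period ring `D2Cris.Bmax F p = A_max[1/t]`).  The clause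
`D2Cris.CrystallineCompatibleAt` (`Theorems/SoloInformedRepairD2Cris`) predicts for the trivial local representation
`𝟙_m` of `Γ_F`, `q_F = p^f`: a `ℚ̄_p`-basis of `D_cris(𝟙_m)` indexed by `Fin (m · f)` in which
`charpoly (φ_D ^ f) = geomFrobPolyOfSatake ι {1,…,1} ^ f = (X - 1)^{m·f}`.  Rungs Λ9
(`Theorems/SoloInformedKzeroDegreeArtin`) and Λ10 (`Theorems/SoloInformedDcrisTrivialCharpoly`) proved this with no
further input when `F` is ABSOLUTELY UNRAMIFIED (`p` a uniformiser).  Their proofs use unramifiedness at exactly one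
point: the Witt description of the invariants,

  (IW) every `Γ_F`-invariant `y ∈ B_max(F)` is `y · pⁿ = ι(W(ι₀) w)` for some `n` and some Witt vector `w` over the
       residue field `k_F` (`ι₀ = D2Cris.resBarField F : k_F ↪ k̄`, `ι : W(k̄) → 𝔸_inf → A_max → B_max(F)`),

which is rung Λ7 `SpecC.forall_galBmax_iff_exists_witt_of_unramified` at `e = 1`.  This file

* §1 re-runs the Frobenius/Artin count of Λ9 and the span argument of Λ10 from the HYPOTHESIS (IW) alone (binder
  `hW`; any `F`): `φ^f = id` on `B_max(F)^{Γ_F}` (`frobBmax_iterate_eq_self_of_wittInvariants`),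
  `(B_max(F)^{Γ_F})^{φ=1} = ℚ_p` (`exists_eq_algebraMap_of_frobBmax_eq_of_wittInvariants`),
  `dim_{ℚ_p} B_max(F)^{Γ_F} = f` (`finrank_fixedSubalgebra_eq_of_wittInvariants`), `dim D_cris(𝟙_m) = m·f`,
  `φ_D^f = 1` on `D_cris(𝟙_m)` and the basis with `charpoly = (X - 1)^{m·f} = geomFrobPolyOfSatake ι {1,…,1}^f`;
* §2 discharges (IW): at `e = 1` by Λ7 (`wittInvariants_of_unramified`), and — the point of the file — for EVERY
  `p`-adic field `F` from Colmez's `t`-divisibility criterion (TC) for `A_max` (binder `hTC`, rung Λ5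
  `SpecC.forall_galBmax_iff_of_tCriterion` + Λ7 `D2Cris.forall_map_residueGal_eq_iff`, `W(k̄)^{Γ_F} = W(k_F)`):
  `wittInvariants_of_tCriterion`;
* §3 ★★ `exists_basis_charpoly_eq_geomFrobPolyOfSatake_pow_of_tCriterion` : **for every `p`-adic field `F` with
  `q_F = p^f` (any ramification), conditional on (TC) alone, `D_cris(𝟙_m)` has a `ℚ̄_p`-basis indexed by
  `Fin (m · f)` in which `charpoly (φ_D ^ f) = geomFrobPolyOfSatake ι {1,…,1} ^ f`** — the complete `𝟙_m` instance
  of the conclusion of `CrystallineCompatibleAt`, together with `dim_{ℚ_p} B_max(F)^{Γ_F} = f`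
  (`finrank_fixedSubalgebra_eq_of_tCriterion`), `φ^f = id` on the invariants and `(B_max(F)^{Γ_F})^{φ=1} = ℚ_p`
  (`exists_eq_algebraMap_of_frobBmax_eq_of_tCriterion`) under (TC);
* §4 the forms with `θ` surjective and the `F^nr` instance facts discharged from `valuation F p < 1`.

(TC) is Galois-free and `F`-free period-ring algebra (Colmez 1998 §III.2–III.3; its `φ = p` case is the tree's
`exists_sq_mul_eq_zpToAinf_mul_tBmax'`); it is the single input now standing between the tree and the `𝟙_m` instance
of the clause at ramified places.

References: Colmez, Ann. of Math. 148 (1998), §III.2–III.3; Fontaine, Astérisque 223 (1994), Exp. II §2.3, Exp. III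
§1.5, §4.1, Exp. VIII §2.3.7; Serre, *Local Fields* (1979), Ch. II §§5–6; Artin, *Galois Theory* (1944), Thm. 14;
Buzzard–Gee, LMS LNS 414 (2014), Conj. 3.2.2.
-/

noncomputable section

open scoped MatrixGroups TensorProduct ValuativeRel
open WittVector Field IsLocalRing ValuativeRel
open Literature.NumberTheory.GaloisRepresentations Literature.NumberTheory.PAdicHodge
open Literature.NumberTheory.GaloisRepresentations.IsNonarchimedeanLocalField

namespace Summit.Langlands.Langlands.Theorems

namespace SpecC

variable {F : Type} [Field F] [ValuativeRel F] [TopologicalSpace F] [IsNonarchimedeanLocalField F] [CharZero F]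
  {p : ℕ} [Fact p.Prime] [Fact (¬ IsUnit (p : integerC F))] [IsAdicComplete (Ideal.span {(p : integerC F)}) (integerC F)]

/-! ### §1 From the Witt description (IW) of the invariants: Frobenius order, fixed points, dimensions, `φ_D^f = 1` -/

section WittInvariants

variable [Fact (¬ IsUnit (p : maxUnramifiedCompletion F))] [CharP (IsLocalRing.ResidueField (maxUnramifiedCompletion F)) p]
  (hp : valuation F p < 1) (hF : Function.Surjective (fontaineTheta (integerC F) p))
  (hW : ∀ y : D2Cris.Bmax F p, (∀ σ : absoluteGaloisGroup F, D2Cris.galBmax σ y = y) →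
    ∃ (n : ℕ) (w : WittVector p 𝓀[F]),
      y * (p : D2Cris.Bmax F p) ^ n =
        algebraMap (BmaxPlus F p) (D2Cris.Bmax F p)
          (ainfToBmaxPlus F p (wittToAinf F p (WittVector.map (D2Cris.resBarField F) w))))
  {m : ℕ}

include hW in
/-- **`φ^f = id` on `B_max(F)^{Γ_F}` from (IW)** (`q_F = p^f`): an invariant is `p⁻ⁿ ι(W(ι₀) w)` and `φ^f` raises the
Witt coordinates of `W(ι₀) w` to the `q_F`-th power, the identity on `k_F` (Λ9 `iterate_frobenius_map_resBarField`).
[cite: Colmez1998Annals, §III.2] [cite: FontaineAsterisque223III, Exp. II §2.3] -/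
theorem frobBmax_iterate_eq_self_of_wittInvariants {f : ℕ} (hq : residueFieldCard F = p ^ f)
    {y : D2Cris.Bmax F p} (hy : ∀ σ : absoluteGaloisGroup F, D2Cris.galBmax σ y = y) :
    (D2Cris.frobBmax F p)^[f] y = y := by
  obtain ⟨n, w, hw⟩ := hW y hy
  have h : (D2Cris.frobBmax F p)^[f] y * (p : D2Cris.Bmax F p) ^ n = y * (p : D2Cris.Bmax F p) ^ n := by
    rw [← frobBmax_iterate_mul_natCast_pow, hw, frobBmax_iterate_algebraMap_wittToAinf,
      iterate_frobenius_map_resBarField hq]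
  exact ((D2Cris.isUnit_natCast_bmax (F := F) (p := p)).pow n).mul_left_inj.1 h

include hp hW in
/-- **`(B_max(F)^{Γ_F})^{φ = 1} = ℚ_p` from (IW)**: an invariant `y = p⁻ⁿ ι(z)`, `z ∈ W(k̄)`, with `φ y = y` has
`φ z = z` (`ι` injective and `φ`-equivariant), so `z ∈ ℤ_p` (`D2Cris.exists_eq_zpToWitt_of_frobenius_eq`) and
`y ∈ ℚ_p`. [cite: Colmez1998Annals, §III.2] [cite: SerreLocalFields1979, Ch. II §6] -/
theorem exists_eq_algebraMap_of_frobBmax_eq_of_wittInvariants {y : D2Cris.Bmax F p}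
    (hy : ∀ σ : absoluteGaloisGroup F, D2Cris.galBmax σ y = y) (hφ : D2Cris.frobBmax F p y = y) :
    ∃ c : ℚ_[p], y = algebraMap ℚ_[p] (D2Cris.Bmax F p) c := by
  haveI : CharP (ResidueField (integerC F)) p := charP_residueField_integerC
  obtain ⟨n, w, hw⟩ := hW y hy
  generalize hz : WittVector.map (D2Cris.resBarField F) w = z at hw
  have h1 : algebraMap (BmaxPlus F p) (D2Cris.Bmax F p) (ainfToBmaxPlus F p (wittToAinf F p
        (WittVector.frobenius (p := p) (R := ResidueField (maxUnramifiedCompletion F)) z))) =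
      algebraMap (BmaxPlus F p) (D2Cris.Bmax F p) (ainfToBmaxPlus F p (wittToAinf F p z)) := by
    rw [wittToAinf_frobenius, ← frobBmaxPlus_ainfToBmaxPlus, ← D2Cris.frobBmax_algebraMap, ← hw, map_mul, map_pow,
      map_natCast, hφ]
  have h2 : WittVector.frobenius z = z := ainfToBmaxPlus_wittToAinf_injective (algebraMap_bmax_injective hp h1)
  obtain ⟨c, hc⟩ := D2Cris.exists_eq_zpToWitt_of_frobenius_eq h2
  have h3 := RingHom.congr_fun (D2Cris.wittToAinf_comp_zpToWitt (F := F) (p := p)) c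
  rw [RingHom.comp_apply] at h3
  refine exists_eq_algebraMap_of_mul_pow_eq (n := n) (c := (c : ℚ_[p])) ?_
  rw [hw, hc, h3, ← D2Cris.zpToBmax_eq_algebraMap]
  rfl

include hW in
/-- **`φ^f = id` on `W = B_max(F)^{Γ_F}`** for the endomorphism `phiInv` of Λ9, from (IW). [cite: Colmez1998Annals, §III.2] -/
theorem phiInv_iterate_eq_self_of_wittInvariants {f : ℕ} (hq : residueFieldCard F = p ^ f)
    (w : D2Cris.fixedSubalgebra (D2Cris.galBmaxAlgHom (F := F) (p := p))) : phiInv^[f] w = w :=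
  Subtype.ext <| by
    rw [coe_phiInv_iterate]
    exact frobBmax_iterate_eq_self_of_wittInvariants hW hq (forall_galBmax_coe w)

include hp hW in
/-- **`W^{φ = 1} = ℚ_p` for `W = B_max(F)^{Γ_F}`** and the endomorphism `phiInv`, from (IW).
[cite: Colmez1998Annals, §III.2] -/
theorem exists_eq_algebraMap_of_phiInv_eq_of_wittInvariants
    (w : D2Cris.fixedSubalgebra (D2Cris.galBmaxAlgHom (F := F) (p := p))) (hw : phiInv w = w) :
    ∃ c : ℚ_[p], w = algebraMap ℚ_[p] (D2Cris.fixedSubalgebra (D2Cris.galBmaxAlgHom (F := F) (p := p))) c := by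
  have h : D2Cris.frobBmax F p (w : D2Cris.Bmax F p) = w := by rw [← coe_phiInv, hw]
  obtain ⟨c, hc⟩ := exists_eq_algebraMap_of_frobBmax_eq_of_wittInvariants hp hW (forall_galBmax_coe w) h
  exact ⟨c, Subtype.ext hc⟩

include hp hF hW in
/-- **`dim_{ℚ_p} B_max(F)^{Γ_F} ≤ f` from (IW)** (`q_F = p^f`, `θ` surjective): `W = B_max(F)^{Γ_F}` embeds
`ℚ_p`-linearly into `F` (Λ8b `invariantAlgHom`, `[F : ℚ_p] < ∞`), `φ^f = id` on `W`, `W^{φ=1} = ℚ_p`; Artin's count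
Λ9 `finrank_le_of_iterate_eq_self`. [cite: Colmez1998Annals, §III.2] [cite: SerreLocalFields1979, Ch. II §5] -/
theorem finrank_fixedSubalgebra_le_of_wittInvariants {f : ℕ} (hq : residueFieldCard F = p ^ f) :
    Module.finrank ℚ_[p] (D2Cris.fixedSubalgebra (D2Cris.galBmaxAlgHom (F := F) (p := p))) ≤ f := by
  have hf : 0 < f := Nat.pos_of_ne_zero <| by
    rintro rfl
    rw [pow_zero] at hq
    exact absurd hq (one_lt_residueFieldCard F).ne'
  letI := LocalField.padicAlgebra F p hp
  haveI : FiniteDimensional ℚ_[p] F := PadicBase.instFiniteDimensional (F := F) (p := p) hp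
  exact finrank_le_of_iterate_eq_self (invariantAlgHom hp hF) (invariantAlgHom_injective hp hF) phiInv hf
    (phiInv_iterate_eq_self_of_wittInvariants hW hq) (exists_eq_algebraMap_of_phiInv_eq_of_wittInvariants hp hW)

include hp hF hW in
/-- ★ **`dim_{ℚ_p} B_max(F)^{Γ_F} = f` from (IW)** (`q_F = p^f`, `θ` surjective): `≤` by Artin's count, `≥` by the
`f` Teichmüller periods (Λ8a/Λ8b `le_finrank_fixedSubalgebra_le`). [cite: Colmez1998Annals, §III.2]
[cite: FontaineAsterisque223III, Exp. III §1.5] -/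
theorem finrank_fixedSubalgebra_eq_of_wittInvariants {f : ℕ} (hq : residueFieldCard F = p ^ f) :
    Module.finrank ℚ_[p] (D2Cris.fixedSubalgebra (D2Cris.galBmaxAlgHom (F := F) (p := p))) = f :=
  le_antisymm (finrank_fixedSubalgebra_le_of_wittInvariants hp hF hW hq) (le_finrank_fixedSubalgebra_le hp hF hq).1

include hp hF hW in
/-- ★ **`dim_{ℚ̄_p} D_cris(𝟙_m) = m · f` from (IW)** (`q_F = p^f`, `θ` surjective): Λ8b `finrank_Dcris_one_eq`
(`dim D_cris(𝟙_m) = m · dim_{ℚ_p} B_max(F)^{Γ_F}`). [cite: BuzzardGeeLMS2014, Conj. 3.2.2]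
[cite: FontaineAsterisque223III, Exp. III §1.5] -/
theorem finrank_Dcris_one_eq_of_wittInvariants {f : ℕ} (hq : residueFieldCard F = p ^ f) :
    Module.finrank (PadicAlgCl p)
        (D2Cris.Dcris (F := F) (p := p) (1 : FramedRep (absoluteGaloisGroup F) (PadicAlgCl p) m)) = m * f := by
  rw [finrank_Dcris_one_eq hp hF, finrank_fixedSubalgebra_eq_of_wittInvariants hp hF hW hq]

include hW in
/-- ★ **`φ_D^f = 1` on `D_cris(𝟙_m)` from (IW)** (`q_F = p^f`; neither `θ` surjective nor `valuation F p < 1` is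
needed): `D_cris(𝟙_m)` is spanned by `e_k ⊗ w`, `w ∈ B_max(F)^{Γ_F}` (Λ10 `D2Cris.phiD_pow_eq_one_of_trivial`) and
`φ^f w = w`. [cite: FontaineAsterisque223VIII, §2.3.7] [cite: Colmez1998Annals, §III.2] -/
theorem phiDcris_pow_eq_one_of_wittInvariants {f : ℕ} (hq : residueFieldCard F = p ^ f) :
    D2Cris.phiDcris (F := F) (p := p) (1 : FramedRep (absoluteGaloisGroup F) (PadicAlgCl p) m) ^ f = 1 :=
  D2Cris.phiD_pow_eq_one_of_trivial (ρ := ⇑(1 : FramedRep (absoluteGaloisGroup F) (PadicAlgCl p) m)) (fun _ => rfl)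
    (D2Cris.galBmaxAlgHom (F := F) (p := p)) (D2Cris.frobBmaxAlgHom F p) D2Cris.galBmaxAlgHom_comp_frobBmaxAlgHom
    fun w => by
      rw [coe_frobBmaxAlgHom]
      exact frobBmax_iterate_eq_self_of_wittInvariants hW hq (forall_galBmax_coe w)

include hW in
/-- **`φ_D^f x = x` on `D_cris(𝟙_m)`** from (IW). [cite: FontaineAsterisque223VIII, §2.3.7] -/
theorem phiDcris_pow_apply_of_wittInvariants {f : ℕ} (hq : residueFieldCard F = p ^ f)
    (x : D2Cris.Dcris (F := F) (p := p) (1 : FramedRep (absoluteGaloisGroup F) (PadicAlgCl p) m)) :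
    (D2Cris.phiDcris (1 : FramedRep (absoluteGaloisGroup F) (PadicAlgCl p) m) ^ f) x = x := by
  rw [phiDcris_pow_eq_one_of_wittInvariants hW hq, Module.End.one_apply]

include hW in
/-- **In every finite basis `b` of `D_cris(𝟙_m)`, `charpoly (toMatrix b b (φ_D^f)) = (X - 1)^{|b|}`**, from (IW).
[cite: FontaineAsterisque223VIII, §2.3.7] -/
theorem charpoly_toMatrix_phiDcris_pow_of_wittInvariants {f : ℕ} (hq : residueFieldCard F = p ^ f)
    {ι : Type*} [Fintype ι] [DecidableEq ι]
    (b : Module.Basis ι (PadicAlgCl p) (D2Cris.Dcris (F := F) (p := p) (1 : FramedRep (absoluteGaloisGroup F) (PadicAlgCl p) m))) :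
    (LinearMap.toMatrix b b (D2Cris.phiDcris (1 : FramedRep (absoluteGaloisGroup F) (PadicAlgCl p) m) ^ f)).charpoly =
      (Polynomial.X - 1) ^ Fintype.card ι := by
  rw [phiDcris_pow_eq_one_of_wittInvariants hW hq, LinearMap.toMatrix_one, Matrix.charpoly_one]

include hp hF hW in
/-- ★ **From (IW): a `ℚ̄_p`-basis of `D_cris(𝟙_m)` indexed by `Fin (m · f)` with `charpoly (φ_D^f) = (X - 1)^{m·f}`**
(`q_F = p^f`, `θ` surjective). [cite: BuzzardGeeLMS2014, Conj. 3.2.2] [cite: FontaineAsterisque223VIII, §2.3.7] -/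
theorem exists_basis_charpoly_phiDcris_pow_of_wittInvariants {f : ℕ} (hq : residueFieldCard F = p ^ f) :
    ∃ b : Module.Basis (Fin (m * f)) (PadicAlgCl p)
        (D2Cris.Dcris (F := F) (p := p) (1 : FramedRep (absoluteGaloisGroup F) (PadicAlgCl p) m)),
      (LinearMap.toMatrix b b (D2Cris.phiDcris (1 : FramedRep (absoluteGaloisGroup F) (PadicAlgCl p) m) ^ f)).charpoly =
        (Polynomial.X - 1) ^ (m * f) := by
  haveI := finite_Dcris_one hp hF (m := m)
  haveI : Module.Free (PadicAlgCl p)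
      (D2Cris.Dcris (F := F) (p := p) (1 : FramedRep (absoluteGaloisGroup F) (PadicAlgCl p) m)) :=
    Module.Free.of_divisionRing (PadicAlgCl p)
      (D2Cris.Dcris (F := F) (p := p) (1 : FramedRep (absoluteGaloisGroup F) (PadicAlgCl p) m))
  refine ⟨Module.finBasisOfFinrankEq (PadicAlgCl p)
    (D2Cris.Dcris (F := F) (p := p) (1 : FramedRep (absoluteGaloisGroup F) (PadicAlgCl p) m))
    (finrank_Dcris_one_eq_of_wittInvariants hp hF hW hq), ?_⟩
  rw [charpoly_toMatrix_phiDcris_pow_of_wittInvariants hW hq, Fintype.card_fin]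

include hp hF hW in
/-- ★ **From (IW), in the currency of the clause**: a basis indexed by `Fin (m · f)` with
`charpoly (toMatrix b b (φ_D ^ f)) = geomFrobPolyOfSatake ι {1, …, 1} ^ f` (any `ι : ℚ̄_p ≃ ℂ`).
[cite: BuzzardGeeLMS2014, Conj. 3.2.2] -/
theorem exists_basis_charpoly_eq_geomFrobPolyOfSatake_pow_of_wittInvariants {f : ℕ}
    (hq : residueFieldCard F = p ^ f) (ι : PadicAlgCl p ≃+* ℂ) :
    ∃ b : Module.Basis (Fin (m * f)) (PadicAlgCl p)
        (D2Cris.Dcris (F := F) (p := p) (1 : FramedRep (absoluteGaloisGroup F) (PadicAlgCl p) m)),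
      (LinearMap.toMatrix b b (D2Cris.phiDcris (1 : FramedRep (absoluteGaloisGroup F) (PadicAlgCl p) m) ^ f)).charpoly =
        D2Cris.geomFrobPolyOfSatake ι (Multiset.replicate m 1) ^ f := by
  rw [D2Cris.geomFrobPolyOfSatake_replicate_one_pow]
  exact exists_basis_charpoly_phiDcris_pow_of_wittInvariants hp hF hW hq

end WittInvariants

/-! ### §2 Discharging (IW): at `e = 1` (Λ7), and for every `F` from Colmez's criterion (TC) (Λ5 + Λ7) -/

section Discharge

variable [Fact (¬ IsUnit (p : maxUnramifiedCompletion F))] [CharP (IsLocalRing.ResidueField (maxUnramifiedCompletion F)) p]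
  (hp : valuation F p < 1) (hF : Function.Surjective (fontaineTheta (integerC F) p))
  (hTC : ∀ x : BmaxPlus F p, (∀ n : ℕ, thetaBmaxPlus F p ((frobBmaxPlus F p)^[n] x) = 0) →
    ∃ (k : ℕ) (x' : BmaxPlus F p), (p : BmaxPlus F p) ^ k * x = tBmax * x')
  {m : ℕ}

include hp hF in
/-- **(IW) holds when `F` is absolutely unramified** (`p` a uniformiser): rung Λ7
`forall_galBmax_iff_exists_witt_of_unramified` — so Λ9/Λ10 are the `e = 1` instances of §1.
[cite: Colmez1998Annals, §III.2–III.3] [cite: SerreLocalFields1979, Ch. II §5] -/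
theorem wittInvariants_of_unramified (hur : Irreducible (p : 𝒪[F])) :
    ∀ y : D2Cris.Bmax F p, (∀ σ : absoluteGaloisGroup F, D2Cris.galBmax σ y = y) →
      ∃ (n : ℕ) (w : WittVector p 𝓀[F]),
        y * (p : D2Cris.Bmax F p) ^ n =
          algebraMap (BmaxPlus F p) (D2Cris.Bmax F p)
            (ainfToBmaxPlus F p (wittToAinf F p (WittVector.map (D2Cris.resBarField F) w))) := by
  intro y hy
  haveI : CharP (ResidueField (integerC F)) p := charP_residueField_integerC
  exact (forall_galBmax_iff_exists_witt_of_unramified hp hF hur y).1 hy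

include hp hF hTC in
/-- ★ **(IW) holds for EVERY `p`-adic field `F`, conditional on Colmez's `t`-divisibility criterion (TC)**: under
(TC) an invariant of `A_max[1/t]` is `p⁻ⁿ ι(z)` with `z ∈ W(k̄)^{Γ_F}` (Λ5 `forall_galBmax_iff_of_tCriterion`), and
`W(k̄)^{Γ_F} = W(k_F)` (Λ7 `D2Cris.forall_map_residueGal_eq_iff`). [cite: Colmez1998Annals, §III.2–III.3]
[cite: FontaineAsterisque223III, Exp. III §4.1] -/
theorem wittInvariants_of_tCriterion :
    ∀ y : D2Cris.Bmax F p, (∀ σ : absoluteGaloisGroup F, D2Cris.galBmax σ y = y) →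
      ∃ (n : ℕ) (w : WittVector p 𝓀[F]),
        y * (p : D2Cris.Bmax F p) ^ n =
          algebraMap (BmaxPlus F p) (D2Cris.Bmax F p)
            (ainfToBmaxPlus F p (wittToAinf F p (WittVector.map (D2Cris.resBarField F) w))) := by
  intro y hy
  haveI : CharP (ResidueField (integerC F)) p := charP_residueField_integerC
  obtain ⟨n, z, hz, h⟩ := (forall_galBmax_iff_of_tCriterion hp hF hTC y).1 hy
  obtain ⟨w, rfl⟩ := (D2Cris.forall_map_residueGal_eq_iff z).1 hz
  exact ⟨n, w, h⟩

/-! ### §3 The `𝟙_m` instance of the clause for every `p`-adic field `F`, conditional on (TC) -/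

include hp hF hTC in
/-- ★ **`φ^f = id` on `B_max(F)^{Γ_F}` for EVERY `p`-adic field `F` with `q_F = p^f`, given (TC).**
[cite: Colmez1998Annals, §III.2–III.3] [cite: FontaineAsterisque223III, Exp. II §2.3] -/
theorem frobBmax_iterate_eq_self_of_tCriterion {f : ℕ} (hq : residueFieldCard F = p ^ f)
    {y : D2Cris.Bmax F p} (hy : ∀ σ : absoluteGaloisGroup F, D2Cris.galBmax σ y = y) :
    (D2Cris.frobBmax F p)^[f] y = y :=
  frobBmax_iterate_eq_self_of_wittInvariants (wittInvariants_of_tCriterion hp hF hTC) hq hy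

include hp hF hTC in
/-- ★ **`(B_max(F)^{Γ_F})^{φ = 1} = ℚ_p` for EVERY `p`-adic field `F`, given (TC)** (Fontaine's
`(B_max)^{φ=1} ∩ (B_max)^{Γ_F} = ℚ_p` on the constructed ring, without the fundamental exact sequence).
[cite: Colmez1998Annals, §III.2–III.3] [cite: FontaineAsterisque223III, Exp. III §4.1] -/
theorem exists_eq_algebraMap_of_frobBmax_eq_of_tCriterion {y : D2Cris.Bmax F p}
    (hy : ∀ σ : absoluteGaloisGroup F, D2Cris.galBmax σ y = y) (hφ : D2Cris.frobBmax F p y = y) :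
    ∃ c : ℚ_[p], y = algebraMap ℚ_[p] (D2Cris.Bmax F p) c :=
  exists_eq_algebraMap_of_frobBmax_eq_of_wittInvariants hp (wittInvariants_of_tCriterion hp hF hTC) hy hφ

include hp hF hTC in
/-- ★★ **`dim_{ℚ_p} B_max(F)^{Γ_F} = f` for EVERY `p`-adic field `F` with `q_F = p^f`, given (TC)** (`θ` surjective):
the `ℚ_p`-dimension of `K₀`, with no degree formula and no unramifiedness. [cite: Colmez1998Annals, §III.2–III.3]
[cite: FontaineAsterisque223III, Exp. III §1.5] -/
theorem finrank_fixedSubalgebra_eq_of_tCriterion {f : ℕ} (hq : residueFieldCard F = p ^ f) :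
    Module.finrank ℚ_[p] (D2Cris.fixedSubalgebra (D2Cris.galBmaxAlgHom (F := F) (p := p))) = f :=
  finrank_fixedSubalgebra_eq_of_wittInvariants hp hF (wittInvariants_of_tCriterion hp hF hTC) hq

include hp hF hTC in
/-- ★★ **`dim_{ℚ̄_p} D_cris(𝟙_m) = m · f` for EVERY `p`-adic field `F` with `q_F = p^f`, given (TC)** (`θ`
surjective): the rank clause `n · f(v|p)` of `CrystallineCompatibleAt` at `𝟙_m`, ramified places included.
[cite: BuzzardGeeLMS2014, Conj. 3.2.2] [cite: Colmez1998Annals, §III.2–III.3] -/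
theorem finrank_Dcris_one_eq_of_tCriterion {f : ℕ} (hq : residueFieldCard F = p ^ f) :
    Module.finrank (PadicAlgCl p)
        (D2Cris.Dcris (F := F) (p := p) (1 : FramedRep (absoluteGaloisGroup F) (PadicAlgCl p) m)) = m * f :=
  finrank_Dcris_one_eq_of_wittInvariants hp hF (wittInvariants_of_tCriterion hp hF hTC) hq

include hp hF hTC in
/-- ★ **`φ_D^f = 1` on `D_cris(𝟙_m)` for EVERY `p`-adic field `F` with `q_F = p^f`, given (TC).**
[cite: FontaineAsterisque223VIII, §2.3.7] [cite: Colmez1998Annals, §III.2–III.3] -/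
theorem phiDcris_pow_eq_one_of_tCriterion {f : ℕ} (hq : residueFieldCard F = p ^ f) :
    D2Cris.phiDcris (F := F) (p := p) (1 : FramedRep (absoluteGaloisGroup F) (PadicAlgCl p) m) ^ f = 1 :=
  phiDcris_pow_eq_one_of_wittInvariants (wittInvariants_of_tCriterion hp hF hTC) hq

include hp hF hTC in
/-- ★★ **The `𝟙_m` instance of the conclusion of `CrystallineCompatibleAt` for EVERY `p`-adic field `F`, given
(TC)**: `q_F = p^f`, `θ` surjective ⇒ a `ℚ̄_p`-basis of `D_cris(𝟙_m)` indexed by `Fin (m · f)` with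
`charpoly (φ_D ^ f) = (X - 1)^{m·f}`. [cite: BuzzardGeeLMS2014, Conj. 3.2.2] [cite: FontaineAsterisque223VIII, §2.3.7] -/
theorem exists_basis_charpoly_phiDcris_pow_of_tCriterion {f : ℕ} (hq : residueFieldCard F = p ^ f) :
    ∃ b : Module.Basis (Fin (m * f)) (PadicAlgCl p)
        (D2Cris.Dcris (F := F) (p := p) (1 : FramedRep (absoluteGaloisGroup F) (PadicAlgCl p) m)),
      (LinearMap.toMatrix b b (D2Cris.phiDcris (1 : FramedRep (absoluteGaloisGroup F) (PadicAlgCl p) m) ^ f)).charpoly =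
        (Polynomial.X - 1) ^ (m * f) :=
  exists_basis_charpoly_phiDcris_pow_of_wittInvariants hp hF (wittInvariants_of_tCriterion hp hF hTC) hq

include hp hF hTC in
/-- ★★ **The same in the currency of the clause**: for EVERY `p`-adic `F` with `q_F = p^f`, given (TC), a basis indexed
by `Fin (m · f)` with `charpoly (toMatrix b b (φ_D ^ f)) = geomFrobPolyOfSatake ι {1, …, 1} ^ f` (any `ι : ℚ̄_p ≃ ℂ`).
[cite: BuzzardGeeLMS2014, Conj. 3.2.2] -/
theorem exists_basis_charpoly_eq_geomFrobPolyOfSatake_pow_of_tCriterion {f : ℕ}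
    (hq : residueFieldCard F = p ^ f) (ι : PadicAlgCl p ≃+* ℂ) :
    ∃ b : Module.Basis (Fin (m * f)) (PadicAlgCl p)
        (D2Cris.Dcris (F := F) (p := p) (1 : FramedRep (absoluteGaloisGroup F) (PadicAlgCl p) m)),
      (LinearMap.toMatrix b b (D2Cris.phiDcris (1 : FramedRep (absoluteGaloisGroup F) (PadicAlgCl p) m) ^ f)).charpoly =
        D2Cris.geomFrobPolyOfSatake ι (Multiset.replicate m 1) ^ f :=
  exists_basis_charpoly_eq_geomFrobPolyOfSatake_pow_of_wittInvariants hp hF (wittInvariants_of_tCriterion hp hF hTC) hq ι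

end Discharge

/-! ### §4 Forms with `θ` surjective and the `F^nr` instance facts discharged from `valuation F p < 1` -/

section InputFree

variable (hp : valuation F p < 1)
  (hTC : ∀ x : BmaxPlus F p, (∀ n : ℕ, thetaBmaxPlus F p ((frobBmaxPlus F p)^[n] x) = 0) →
    ∃ (k : ℕ) (x' : BmaxPlus F p), (p : BmaxPlus F p) ^ k * x = tBmax * x')
  {m : ℕ}

include hp hTC in
/-- ★★ **`dim_{ℚ_p} B_max(F)^{Γ_F} = f` for every `p`-adic field `F`, with (TC) as the ONLY hypothesis.**
[cite: Colmez1998Annals, §III.2–III.3] -/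
theorem finrank_fixedSubalgebra_eq_of_tCriterion' {f : ℕ} (hq : residueFieldCard F = p ^ f) :
    Module.finrank ℚ_[p] (D2Cris.fixedSubalgebra (D2Cris.galBmaxAlgHom (F := F) (p := p))) = f := by
  haveI : Fact (¬ IsUnit (p : maxUnramifiedCompletion F)) := ⟨not_isUnit_natCast_completion hp⟩
  haveI : CharP (IsLocalRing.ResidueField (maxUnramifiedCompletion F)) p := charP_residueField_completion
  exact finrank_fixedSubalgebra_eq_of_tCriterion hp (surjective_fontaineTheta_integerC hp) hTC hq

include hp hTC in
/-- ★★ **`dim_{ℚ̄_p} D_cris(𝟙_m) = m · f` for every `p`-adic field `F`, with (TC) as the ONLY hypothesis.**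
[cite: BuzzardGeeLMS2014, Conj. 3.2.2] -/
theorem finrank_Dcris_one_eq_of_tCriterion' {f : ℕ} (hq : residueFieldCard F = p ^ f) :
    Module.finrank (PadicAlgCl p)
        (D2Cris.Dcris (F := F) (p := p) (1 : FramedRep (absoluteGaloisGroup F) (PadicAlgCl p) m)) = m * f := by
  haveI : Fact (¬ IsUnit (p : maxUnramifiedCompletion F)) := ⟨not_isUnit_natCast_completion hp⟩
  haveI : CharP (IsLocalRing.ResidueField (maxUnramifiedCompletion F)) p := charP_residueField_completion
  exact finrank_Dcris_one_eq_of_tCriterion hp (surjective_fontaineTheta_integerC hp) hTC hq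

include hp hTC in
/-- ★ **`φ_D^f = 1` on `D_cris(𝟙_m)` for every `p`-adic field `F`, with (TC) as the ONLY hypothesis.**
[cite: FontaineAsterisque223VIII, §2.3.7] -/
theorem phiDcris_pow_eq_one_of_tCriterion' {f : ℕ} (hq : residueFieldCard F = p ^ f) :
    D2Cris.phiDcris (F := F) (p := p) (1 : FramedRep (absoluteGaloisGroup F) (PadicAlgCl p) m) ^ f = 1 := by
  haveI : Fact (¬ IsUnit (p : maxUnramifiedCompletion F)) := ⟨not_isUnit_natCast_completion hp⟩
  haveI : CharP (IsLocalRing.ResidueField (maxUnramifiedCompletion F)) p := charP_residueField_completion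
  exact phiDcris_pow_eq_one_of_tCriterion hp (surjective_fontaineTheta_integerC hp) hTC hq

include hp hTC in
/-- ★★ **The `𝟙_m` instance of the conclusion of `CrystallineCompatibleAt` for every `p`-adic field `F`, with (TC)
as the ONLY hypothesis**: a `ℚ̄_p`-basis of `D_cris(𝟙_m)` indexed by `Fin (m · f)` (`q_F = p^f`) in which
`charpoly (toMatrix b b (φ_D ^ f)) = geomFrobPolyOfSatake ι {1, …, 1} ^ f`. [cite: BuzzardGeeLMS2014, Conj. 3.2.2]
[cite: Colmez1998Annals, §III.2–III.3] -/
theorem exists_basis_charpoly_eq_geomFrobPolyOfSatake_pow_of_tCriterion' {f : ℕ}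
    (hq : residueFieldCard F = p ^ f) (ι : PadicAlgCl p ≃+* ℂ) :
    ∃ b : Module.Basis (Fin (m * f)) (PadicAlgCl p)
        (D2Cris.Dcris (F := F) (p := p) (1 : FramedRep (absoluteGaloisGroup F) (PadicAlgCl p) m)),
      (LinearMap.toMatrix b b (D2Cris.phiDcris (1 : FramedRep (absoluteGaloisGroup F) (PadicAlgCl p) m) ^ f)).charpoly =
        D2Cris.geomFrobPolyOfSatake ι (Multiset.replicate m 1) ^ f := by
  haveI : Fact (¬ IsUnit (p : maxUnramifiedCompletion F)) := ⟨not_isUnit_natCast_completion hp⟩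
  haveI : CharP (IsLocalRing.ResidueField (maxUnramifiedCompletion F)) p := charP_residueField_completion
  exact exists_basis_charpoly_eq_geomFrobPolyOfSatake_pow_of_tCriterion hp (surjective_fontaineTheta_integerC hp) hTC hq ι

end InputFree

end SpecC

end Summit.Langlands.Langlands.Theorems

end
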